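import Summits.ResolutionOfSingularities.ResolutionOfSingularities.Theorems.EquisingularLiftEquisingularLiftReducedStrictTransformBlowup
import Literature.AlgebraicGeometry.Resolution.BlowupDimension
import Literature.AlgebraicGeometry.Resolution.MaximalPoints
import HarnessLib

/-!
# [OURS · L1 W4.5(b) · EL♮] CARRIER RIGIDITY (a): a horizontal centre whose special fibre is a positive-dimensional
# subset of a point-carrier lies INSIDE the carrier (crux `EquisingularLiftNat` = stmt-ResolutionOfSingularities-20038)

HONEST FRAMING. OURS (cell res-hironaka, crux chain w45b, slot W4.5(b)); NOT a statement of any manuscript; AI-written,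
weaker than expert review. Helper `--supports stmt-ResolutionOfSingularities-20038 --as helper`. Target T-CR of
res-L1-w45b-lead-2's RESHAPE v3 (2026-08-27T05:49:11Z; skeleton `L/w45b/EL-NATURAL/SkeletonELnat-v3.lean`, stub
`stub_elnat_three_isolated`: «after one section per singular point the whole game is played inside POINT-CARRIERS
`E ≅ ℙ²_O`»), plan text L/w45b/CRUX-PLAN.md v3 §1.7 «CARRIER RIGIDITY (a)»; custody res-plan-2 D→L MAP v1.14b.

THE STATEMENT (`subset_preimage_support_of_specialFibre_subset`, set-level). `τ : X′ → X` a blow-up of an integral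
locally Noetherian `X` along `I`, whose support meets the «special fibre» `V(ϖ)` (`ϖ ∈ Γ(X, 𝒪_X)`, e.g. a uniformizer
pulled back from the base DVR) in at most ONE point `t₀` (`I = 𝓘_s` for a section `s`); `C ⊆ X′` closed irreducible,
NOT inside `τ⁻¹V(ϖ)` (horizontal), with special fibre `C ∩ τ⁻¹V(ϖ)` inside the exceptional locus `τ⁻¹(supp I)` and
POSITIVE-DIMENSIONAL (two distinct special points `c₁ ⤳ c₀`; = «infinite» on Noetherian stages). Then `C ⊆ τ⁻¹(supp I)`.
PROOF (dimension theory from the tree, no new algebra). If the generic point `γ` of `C` were off `τ⁻¹(supp I)`: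
`D := τ(C)` is closed (`IsBlowup.isProper`) irreducible, `D ⊄ supp I`, `C ⊆ St D := closure τ⁻¹(D ∖ supp I)`;
`StrataSplit.exists_isBlowup_reducedStrictTransform` (p167331, Stacks 080E) makes `V(St D)_red → V(D)_red` a BLOW-UP, so
codimension does not go up (`IsBlowup.coheight_le`, Matsumura 15.5): `codim_{St D}(c₀) ≤ codim_D(τ c₀)`; the strict
chain `γ ⤳ c₁ ⤳ c₀` gives `codim_{St D}(c₀) ≥ 2`, while `D ∩ V(ϖ) ⊆ {t₀}` and Krull's Hauptidealsatz
(`exists_specializes_coheight_le_one_of_mem_zeroLocus`) give `codim_D(t₀) ≤ 1` — contradiction.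

* `exists_specializes_coheight_le_one_of_mem_zeroLocus` — Krull's principal ideal theorem for the zero locus of a global
  section on a locally Noetherian scheme (pattern of `IsEffectiveCartier.exists_specializes_coheight_le_one`,
  `Resolution/AlterationsMultisectionLocalStepProofs`, which is stated for effective Cartier ideal sheaves).
* `subset_preimage_support_of_specialFibre_subset` — CARRIER RIGIDITY (a), abstract form above.
* `finite_maxPoints_of_isClosed`, `exists_specializes_ne_of_infinite` — on a compact locally Noetherian scheme a closed
  set has finitely many maximal points (Stacks 0BA8), so an INFINITE closed set contains two distinct points `c₁ ⤳ c₀`.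
* `subset_preimage_support_of_infinite_specialFibre` — CARRIER RIGIDITY (a) in lead-2's wording «infinite special fibre»,
  over a compact base stage.
* `zeroLocus_appTop_eq_preimage_closedPoint`, `support_subset_preimage_of_flat_of_infinite_specialFibre` — the SCHEME-LEVEL
  EL♮ spelling asked by res-L1-w45b-lead-2 (RECONCILE 05:57:35Z): `O` a DVR, `r : P → Spec O` proper, `s` a section (closed
  immersion, `s ≫ r = 𝟙`), `τ : Bl → P` a blow-up along `ker s`, `C` an ideal sheaf on `Bl` with `V(C)` integral and
  `V(C) → Spec O` flat, special-fibre points of `supp C` inside `τ⁻¹ supp (ker s)` and infinitely many ⇒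
  `supp C ⊆ τ⁻¹ supp (ker s)` (flat ⇒ horizontal by `Flat.generalizingMap`).

References: Matsumura, *Commutative Ring Theory* Thm. 15.5 / 13.5 [Matsumura1987]; Stacks Project Tags 080E, 00KV, 02IZ
[StacksProject]; Görtz–Wedhorn I Prop. 13.96 [GortzWedhorn2020] — through the cited tree files. OURS planning texts (index
only): L/w45b/CRUX-PLAN.md v3 §1.7, L/res-L1-w45b-lead-2/SkeletonELnat-v3.lean.
-/

set_option linter.dupNamespace false -- mandated namespace `Summit.<Summit>.<Problem>` of this single-conjunct summit

open CategoryTheory AlgebraicGeometry TopologicalSpace Topology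
open AlgebraicGeometry.Scheme.IdealSheafData Literature.AlgebraicGeometry.Resolution

universe u

namespace Summit.ResolutionOfSingularities.ResolutionOfSingularities.Cruxes.EquisingularLiftNat.Sections

/-! ## Krull's principal ideal theorem for the zero locus of a section -/

/-- On an affine open `U`, the point of `X` defined by a prime `𝔯` of `Γ(X, U)` lies in the basic open `X_s`,
`s ∈ Γ(X, U)`, iff `s ∉ 𝔯`. [folklore] -/
private theorem fromSpec_mem_basicOpen_iff' {X : Scheme.{u}} {U : X.Opens} (hU : IsAffineOpen U) (s : Γ(X, U))
    (𝔯 : Spec Γ(X, U)) : hU.fromSpec 𝔯 ∈ X.basicOpen s ↔ s ∉ 𝔯.asIdeal := by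
  rw [← PrimeSpectrum.mem_basicOpen]
  change 𝔯 ∈ hU.fromSpec ⁻¹ᵁ X.basicOpen s ↔ _
  rw [hU.fromSpec_preimage_basicOpen]
  rfl

/-- **Krull's Hauptidealsatz for the zero locus of one section.** On a locally Noetherian scheme `Z`, every point `w` of
the zero locus `V(g)` of a global section `g` is a specialisation of a point `ξ ∈ V(g)` of coheight (codimension) `≤ 1`:
on an affine chart `U ∋ w`, a minimal prime of `(g|_U)` below the prime of `w` has height `≤ 1` (Mathlib
`Ideal.height_le_one_of_isPrincipal_of_mem_minimalPrimes`), and heights of primes are coheights of points (Stacks 02IZ,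
Mathlib `idealHeight_eq_coheight`, `coheight_eq_of_isOpenImmersion`). [cite: StacksProject, Tag 00KV and Tag 02IZ] -/
theorem exists_specializes_coheight_le_one_of_mem_zeroLocus {Z : Scheme.{u}} [IsLocallyNoetherian Z]
    (g : Γ(Z, ⊤)) {w : Z} (hw : w ∈ Z.zeroLocus ({g} : Set Γ(Z, ⊤))) :
    ∃ ξ : Z, ξ ∈ Z.zeroLocus ({g} : Set Γ(Z, ⊤)) ∧ ξ ⤳ w ∧ Order.coheight ξ ≤ 1 := by
  obtain ⟨U, hU, hwU, -⟩ := exists_isAffineOpen_mem_and_subset (x := w) (U := ⊤) (Opens.mem_top w)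
  haveI : IsNoetherianRing Γ(Z, U) := IsLocallyNoetherian.component_noetherian ⟨U, hU⟩
  -- the restriction `h = g|_U` and its basic open `Z_h = U ∩ Z_g`
  set h : Γ(Z, U) := Z.presheaf.map (homOfLE le_top).op g with hh
  have hbo : Z.basicOpen h = U ⊓ Z.basicOpen g := Scheme.basicOpen_res _ _ _
  have hwg : w ∉ Z.basicOpen g := by
    rw [Scheme.mem_zeroLocus_iff] at hw
    exact hw g rfl
  -- the prime of `w` contains `h`
  set 𝔮 := hU.primeIdealOf ⟨w, hwU⟩ with h𝔮
  have hw𝔮 : hU.fromSpec 𝔮 = w := hU.fromSpec_primeIdealOf ⟨w, hwU⟩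
  have hh𝔮 : h ∈ 𝔮.asIdeal := by
    by_contra hn
    have hmem := (fromSpec_mem_basicOpen_iff' hU h 𝔮).mpr hn
    rw [hw𝔮, hbo] at hmem
    exact hwg hmem.2
  -- a minimal prime of `(h)` below it
  obtain ⟨𝔭, h𝔭, h𝔭𝔮⟩ := Ideal.exists_minimalPrimes_le
    (show Ideal.span {h} ≤ 𝔮.asIdeal from (Ideal.span_singleton_le_iff_mem _).mpr hh𝔮)
  haveI h𝔭p : 𝔭.IsPrime := h𝔭.1.1
  refine ⟨hU.fromSpec ⟨𝔭, h𝔭p⟩, ?_, ?_, ?_⟩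
  · -- `ξ ∈ U` and `ξ ∉ Z_h = U ∩ Z_g`, hence `ξ ∉ Z_g`
    have h1 : hU.fromSpec ⟨𝔭, h𝔭p⟩ ∉ Z.basicOpen h := by
      rw [fromSpec_mem_basicOpen_iff' hU h]
      exact not_not.mpr (h𝔭.1.2 (Ideal.subset_span rfl))
    have h2 : hU.fromSpec ⟨𝔭, h𝔭p⟩ ∈ (U : Set Z) := by
      rw [← hU.range_fromSpec]
      exact Set.mem_range_self _
    rw [Scheme.mem_zeroLocus_iff]
    intro f hf hmem
    rw [Set.mem_singleton_iff] at hf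
    subst hf
    rw [hbo] at h1
    exact h1 ⟨h2, hmem⟩
  · rw [← hw𝔮]
    exact ((PrimeSpectrum.le_iff_specializes _ _).mp
      (show (⟨𝔭, h𝔭p⟩ : Spec Γ(Z, U)) ≤ 𝔮 from h𝔭𝔮)).map hU.fromSpec.continuous
  · rw [show hU.fromSpec ⟨𝔭, h𝔭p⟩ = hU.fromSpec.base ⟨𝔭, h𝔭p⟩ from rfl,
      coheight_eq_of_isOpenImmersion, ← idealHeight_eq_coheight]
    exact Ideal.height_le_one_of_isPrincipal_of_mem_minimalPrimes (Ideal.span {h}) 𝔭 h𝔭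

/-! ## Carrier rigidity (a) -/

/-- **[OURS · L1 W4.5(b)] CARRIER RIGIDITY (a), abstract set-level form** (target T-CR of res-L1-w45b-lead-2's RESHAPE
v3; CRUX-PLAN v3 §1.7). Let `τ : X′ → X` be a blow-up of the integral locally Noetherian scheme `X` along `I`, `ϖ` a
global section of `𝒪_X` (the «special fibre» is `V(ϖ)`), and `t₀` a point with `supp I ∩ V(ϖ) ⊆ {t₀}` (the centre has
at most one special point — a SECTION). Let `C ⊆ X′` be closed and irreducible, not contained in the special fibre
`τ⁻¹V(ϖ)` (horizontal), whose special fibre `C ∩ τ⁻¹V(ϖ)` lies in the exceptional locus `τ⁻¹(supp I)` and contains two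
distinct points `c₁ ⤳ c₀` (positive-dimensional). Then `C ⊆ τ⁻¹(supp I)`: the whole of `C` lies in the carrier
`E = τ⁻¹(supp I)`. Proof in the module docstring (strict transform of `D = τ(C)` is a blow-up of `V(D)_red` ⇒
codimension does not go up; Krull at `t₀`; the strict chain `γ ⤳ c₁ ⤳ c₀`). NOT a statement of the manuscript.
[cite: StacksProject, Tag 080E; Matsumura1987, Thm. 15.5] -/
theorem subset_preimage_support_of_specialFibre_subset {X X' : Scheme.{0}} [IsIntegral X]
    [IsLocallyNoetherian X] (τ : X' ⟶ X) (I : X.IdealSheafData) (hτ : IsBlowup τ I)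
    (ϖ : Γ(X, ⊤)) (t₀ : X) (hI : (I.support : Set X) ∩ X.zeroLocus {ϖ} ⊆ {t₀})
    {C : Set X'} (hC : IsClosed C) (hCirr : IsIrreducible C)
    (hCgen : ¬ C ⊆ τ ⁻¹' X.zeroLocus {ϖ})
    (hCsp : C ∩ τ ⁻¹' X.zeroLocus {ϖ} ⊆ τ ⁻¹' (I.support : Set X))
    (hCpos : ∃ c₀ c₁ : X', c₀ ∈ C ∩ τ ⁻¹' X.zeroLocus {ϖ} ∧ c₁ ∈ C ∩ τ ⁻¹' X.zeroLocus {ϖ} ∧ c₁ ⤳ c₀ ∧ c₁ ≠ c₀) :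
    C ⊆ τ ⁻¹' (I.support : Set X) := by
  haveI : IsProper τ := hτ.isProper
  haveI : IsLocallyNoetherian X' := LocallyOfFiniteType.isLocallyNoetherian τ
  have hF : IsClosed (X.zeroLocus ({ϖ} : Set Γ(X, ⊤))) := X.zeroLocus_isClosed _
  obtain ⟨c₀, c₁, hc₀, hc₁, h10, hne⟩ := hCpos
  -- the generic point `γ` of `C`
  obtain ⟨γ, hγ⟩ := QuasiSober.sober hCirr hC
  by_contra hnot
  have hγE : γ ∉ τ ⁻¹' (I.support : Set X) := fun h =>
    hnot ((hγ.mem_closed_set_iff (I.support.isClosed.preimage τ.continuous)).mp h)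
  have hγF : γ ∉ τ ⁻¹' X.zeroLocus ({ϖ} : Set Γ(X, ⊤)) := fun h =>
    hCgen ((hγ.mem_closed_set_iff (hF.preimage τ.continuous)).mp h)
  -- the image `D = τ(C)`: closed (`τ` is proper), irreducible, not inside the centre, one special point
  have hD : IsClosed (τ '' C) := τ.isClosedMap _ hC
  have hDirr : IsIrreducible (τ '' C) := hCirr.image _ τ.continuous.continuousOn
  have hDI : ¬ τ '' C ⊆ (I.support : Set X) := fun h => hγE (h ⟨γ, hγ.mem, rfl⟩)
  have hDF : τ '' C ∩ X.zeroLocus ({ϖ} : Set Γ(X, ⊤)) ⊆ {t₀} := by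
    rintro _ ⟨⟨c, hc, rfl⟩, hcF⟩
    exact hI ⟨hCsp ⟨hc, hcF⟩, hcF⟩
  -- the reduced strict transform of `D` is a blow-up of `V(D)_red`
  obtain ⟨ρ, hρι, -, hρb⟩ :=
    Summit.ResolutionOfSingularities.ResolutionOfSingularities.Cruxes.EquisingularLift.StrataSplit.exists_isBlowup_reducedStrictTransform
      X X' τ I hτ (τ '' C) hD hDirr hDI
  haveI : IsIntegral (vanishingIdeal (⟨τ '' C, hD⟩ : Closeds X)).subscheme :=
    ComponentGluing.isIntegral_subscheme_vanishingIdeal _ hDirr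
  haveI : IsLocallyNoetherian (vanishingIdeal (⟨τ '' C, hD⟩ : Closeds X)).subscheme :=
    LocallyOfFiniteType.isLocallyNoetherian (vanishingIdeal (⟨τ '' C, hD⟩ : Closeds X)).subschemeι
  -- `C` lies in the strict transform `St D = closure τ⁻¹(D ∖ supp I)`
  have hCS : C ⊆ closure (τ ⁻¹' (τ '' C \ (I.support : Set X))) := by
    have h1 : γ ∈ τ ⁻¹' (τ '' C \ (I.support : Set X)) := ⟨⟨γ, hγ.mem, rfl⟩, hγE⟩
    have h2 : closure ({γ} : Set X') ⊆ closure (τ ⁻¹' (τ '' C \ (I.support : Set X))) :=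
      closure_mono (Set.singleton_subset_iff.mpr h1)
    rwa [hγ.def] at h2
  -- the points of `V(St D)_red` over `c₀`, `c₁`, `γ`
  have hpt : ∀ x ∈ closure (τ ⁻¹' (τ '' C \ (I.support : Set X))),
      ∃ z : ↥(vanishingIdeal (⟨closure (τ ⁻¹' (τ '' C \ (I.support : Set X))), isClosed_closure⟩ :
        Closeds X')).subscheme,
        (vanishingIdeal (⟨closure (τ ⁻¹' (τ '' C \ (I.support : Set X))), isClosed_closure⟩ :
          Closeds X')).subschemeι z = x := by
    intro x hx
    have hx' : x ∈ Set.range (vanishingIdeal (⟨closure (τ ⁻¹' (τ '' C \ (I.support : Set X))),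
        isClosed_closure⟩ : Closeds X')).subschemeι := by
      rw [ComponentGluing.range_subschemeι_vanishingIdeal]; exact hx
    exact hx'
  obtain ⟨z₀, hz₀⟩ := hpt c₀ (hCS hc₀.1)
  obtain ⟨z₁, hz₁⟩ := hpt c₁ (hCS hc₁.1)
  obtain ⟨zγ, hzγ⟩ := hpt γ (hCS hγ.mem)
  have hind : IsInducing (vanishingIdeal (⟨closure (τ ⁻¹' (τ '' C \ (I.support : Set X))),
      isClosed_closure⟩ : Closeds X')).subschemeι :=
    (Scheme.Hom.isClosedEmbedding _).isEmbedding.isInducing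
  -- the strict chain `z₀ < z₁ < zγ` (specialisation order: `a ≤ b ↔ b ⤳ a`)
  have h01 : z₀ < z₁ := by
    refine ⟨hind.specializes_iff.mp (by rw [hz₁, hz₀]; exact h10), fun h => hne ?_⟩
    have h' : c₀ ⤳ c₁ := by
      have h'' := hind.specializes_iff.mpr h
      rwa [hz₀, hz₁] at h''
    exact (h10.antisymm h').eq
  have h1γ : z₁ < zγ := by
    refine ⟨hind.specializes_iff.mp (by rw [hzγ, hz₁]; exact hγ.specializes hc₁.1), fun h => hγF ?_⟩
    have h' : c₁ ⤳ γ := by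
      have h'' := hind.specializes_iff.mpr h
      rwa [hz₁, hzγ] at h''
    exact h'.mem_closed (hF.preimage τ.continuous) hc₁.2
  have hlow : (2 : ℕ∞) ≤ Order.coheight z₀ := by -- the strict chain `z₀ < z₁ < zγ`
    have a := Order.coheight_add_one_le h01
    have b := Order.coheight_add_one_le h1γ
    have b' : (1 : ℕ∞) ≤ Order.coheight z₁ := le_trans le_add_self b
    have a' : (1 : ℕ∞) + 1 ≤ Order.coheight z₁ + 1 := add_le_add b' le_rfl
    rw [one_add_one_eq_two] at a'
    exact a'.trans a
  have hup : Order.coheight z₀ ≤ 1 := by -- blow-up does not raise codimension; Krull at the special point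
    refine (hρb.coheight_le z₀).trans ?_
    have hw : (vanishingIdeal (⟨τ '' C, hD⟩ : Closeds X)).subschemeι (ρ z₀) = τ c₀ := by
      rw [← Scheme.Hom.comp_apply, hρι, Scheme.Hom.comp_apply, hz₀]
    -- the special fibre of `V(D)_red` is the zero locus of `ϖ|_D`
    have hpre : (vanishingIdeal (⟨τ '' C, hD⟩ : Closeds X)).subschemeι ⁻¹' X.zeroLocus ({ϖ} : Set Γ(X, ⊤)) =
        (vanishingIdeal (⟨τ '' C, hD⟩ : Closeds X)).subscheme.zeroLocus
          ({(vanishingIdeal (⟨τ '' C, hD⟩ : Closeds X)).subschemeι.appTop ϖ} :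
            Set Γ((vanishingIdeal (⟨τ '' C, hD⟩ : Closeds X)).subscheme, ⊤)) := by
      rw [Scheme.preimage_zeroLocus, Set.image_singleton]
      rfl
    have hwF : ρ z₀ ∈ (vanishingIdeal (⟨τ '' C, hD⟩ : Closeds X)).subscheme.zeroLocus
        ({(vanishingIdeal (⟨τ '' C, hD⟩ : Closeds X)).subschemeι.appTop ϖ} :
          Set Γ((vanishingIdeal (⟨τ '' C, hD⟩ : Closeds X)).subscheme, ⊤)) := by
      rw [← hpre, Set.mem_preimage, hw]
      exact hc₀.2
    obtain ⟨ξ, hξF, hξw, hξ⟩ := exists_specializes_coheight_le_one_of_mem_zeroLocus _ hwF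
    have hξD : (vanishingIdeal (⟨τ '' C, hD⟩ : Closeds X)).subschemeι ξ ∈ τ '' C :=
      ComponentGluing.mem_of_subscheme_vanishingIdeal (⟨τ '' C, hD⟩ : Closeds X) ξ
    have hξF' : (vanishingIdeal (⟨τ '' C, hD⟩ : Closeds X)).subschemeι ξ ∈ X.zeroLocus ({ϖ} : Set Γ(X, ⊤)) := by
      rw [← Set.mem_preimage, hpre]
      exact hξF
    have hwD : (vanishingIdeal (⟨τ '' C, hD⟩ : Closeds X)).subschemeι (ρ z₀) ∈ τ '' C :=
      ComponentGluing.mem_of_subscheme_vanishingIdeal (⟨τ '' C, hD⟩ : Closeds X) (ρ z₀)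
    have e1 : (vanishingIdeal (⟨τ '' C, hD⟩ : Closeds X)).subschemeι ξ = t₀ := hDF ⟨hξD, hξF'⟩
    have e2 : (vanishingIdeal (⟨τ '' C, hD⟩ : Closeds X)).subschemeι (ρ z₀) = t₀ :=
      hDF ⟨hwD, by rw [hw]; exact hc₀.2⟩
    have e3 : ξ = ρ z₀ :=
      (vanishingIdeal (⟨τ '' C, hD⟩ : Closeds X)).subschemeι.isClosedEmbedding.injective (e1.trans e2.symm)
    rw [← e3]
    exact hξ
  exact absurd (hlow.trans hup) (by decide)

/-! ## The «infinite special fibre» form (Noetherian stages) -/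

/-- On a compact locally Noetherian scheme, a closed subset has finitely many maximal points (every point has a
neighbourhood meeting finitely many of them, `exists_isOpen_finite_maxPoints_inter`, Stacks 0BA8; compactness).
[cite: StacksProject, Tag 0BA8] -/
theorem finite_maxPoints_of_isClosed {Y : Scheme.{u}} [IsLocallyNoetherian Y] [CompactSpace Y] {S : Set Y}
    (hS : IsClosed S) : (maxPoints S).Finite := by
  choose U hUo htU hUf using fun t : Y => exists_isOpen_finite_maxPoints_inter hS t
  obtain ⟨T, hT⟩ := isCompact_univ.elim_finite_subcover U hUo (fun t _ => Set.mem_iUnion.mpr ⟨t, htU t⟩)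
  refine ((T.finite_toSet).biUnion fun t _ => hUf t).subset ?_
  intro η hη
  obtain ⟨t, htT, hηt⟩ : ∃ t ∈ T, η ∈ U t := by simpa using hT (Set.mem_univ η)
  exact Set.mem_biUnion htT ⟨hη, hηt⟩

/-- An INFINITE closed subset of a compact locally Noetherian scheme contains two distinct points `c₁ ⤳ c₀` (a point
that is not maximal has a proper generisation inside the set; the maximal points are finitely many). [folklore] -/
theorem exists_specializes_ne_of_infinite {Y : Scheme.{u}} [IsLocallyNoetherian Y] [CompactSpace Y] {S : Set Y}
    (hS : IsClosed S) (hinf : S.Infinite) : ∃ c₀ c₁ : Y, c₀ ∈ S ∧ c₁ ∈ S ∧ c₁ ⤳ c₀ ∧ c₁ ≠ c₀ := by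
  have hfin := finite_maxPoints_of_isClosed hS
  obtain ⟨s, hsS, hsmax⟩ : ∃ s ∈ S, s ∉ maxPoints S := by
    by_contra h
    push Not at h
    exact hinf (hfin.subset fun s hs => h s hs)
  rw [mem_maxPoints_iff] at hsmax
  push Not at hsmax
  obtain ⟨c₁, hc₁S, hc₁s, hne⟩ := hsmax hsS
  exact ⟨s, c₁, hsS, hc₁S, hc₁s, hne⟩

/-- **[OURS · L1 W4.5(b)] CARRIER RIGIDITY (a), «infinite special fibre» form** (lead-2's wording): as
`subset_preimage_support_of_specialFibre_subset`, over a COMPACT base stage `X` (then the blow-up `X′` is compact and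
locally Noetherian), with the positive-dimensionality hypothesis replaced by «the special fibre `C ∩ τ⁻¹V(ϖ)` is
INFINITE». NOT a statement of the manuscript. [cite: StacksProject, Tag 080E; Matsumura1987, Thm. 15.5] -/
theorem subset_preimage_support_of_infinite_specialFibre {X X' : Scheme.{0}} [IsIntegral X]
    [IsLocallyNoetherian X] [CompactSpace X] (τ : X' ⟶ X) (I : X.IdealSheafData) (hτ : IsBlowup τ I)
    (ϖ : Γ(X, ⊤)) (t₀ : X) (hI : (I.support : Set X) ∩ X.zeroLocus {ϖ} ⊆ {t₀})
    {C : Set X'} (hC : IsClosed C) (hCirr : IsIrreducible C)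
    (hCgen : ¬ C ⊆ τ ⁻¹' X.zeroLocus {ϖ})
    (hCsp : C ∩ τ ⁻¹' X.zeroLocus {ϖ} ⊆ τ ⁻¹' (I.support : Set X))
    (hCinf : (C ∩ τ ⁻¹' X.zeroLocus {ϖ}).Infinite) :
    C ⊆ τ ⁻¹' (I.support : Set X) := by
  haveI : IsProper τ := hτ.isProper
  haveI : IsLocallyNoetherian X' := LocallyOfFiniteType.isLocallyNoetherian τ
  haveI : CompactSpace X' := QuasiCompact.compactSpace_of_compactSpace τ
  have hS : IsClosed (C ∩ τ ⁻¹' X.zeroLocus ({ϖ} : Set Γ(X, ⊤))) :=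
    hC.inter ((X.zeroLocus_isClosed _).preimage τ.continuous)
  obtain ⟨c₀, c₁, hc₀, hc₁, h, hne⟩ := exists_specializes_ne_of_infinite hS hCinf
  exact subset_preimage_support_of_specialFibre_subset τ I hτ ϖ t₀ hI hC hCirr hCgen hCsp
    ⟨c₀, c₁, hc₀, hc₁, h, hne⟩

/-! ## Scheme-level form in the EL♮ currency (res-L1-w45b-lead-2 RECONCILE 2026-08-27T05:57:35Z) -/

/-- For a DVR `O` with uniformizer `ϖ` and a scheme `r : P → Spec O` over it, the zero locus of `ϖ` pulled back to `P`
is the special fibre `r⁻¹{s₀}` (the primes of `O` containing `ϖ` are exactly the maximal ideal). [folklore] -/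
theorem zeroLocus_appTop_eq_preimage_closedPoint {O : Type} [CommRing O] [IsDomain O] [IsDiscreteValuationRing O]
    {ϖ : O} (hϖ : Irreducible ϖ) {P : Scheme.{0}} (r : P ⟶ Spec (.of O)) :
    P.zeroLocus ({r.appTop ((Scheme.ΓSpecIso (.of O)).inv ϖ)} : Set Γ(P, ⊤)) =
      r ⁻¹' {IsLocalRing.closedPoint O} := by
  have h1 : (Spec (.of O)).zeroLocus ({(Scheme.ΓSpecIso (.of O)).inv ϖ} : Set Γ(Spec (.of O), ⊤)) =
      {IsLocalRing.closedPoint O} := by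
    have h := Spec_zeroLocus_eq_zeroLocus (R := .of O) {ϖ}
    rw [Set.image_singleton] at h
    rw [h]
    ext 𝔭
    rw [PrimeSpectrum.mem_zeroLocus, Set.singleton_subset_iff, SetLike.mem_coe]
    constructor
    · intro hmem
      have hne : 𝔭.asIdeal ≠ ⊥ := by
        intro h0
        rw [h0, Ideal.mem_bot] at hmem
        exact hϖ.ne_zero hmem
      exact (PrimeSpectrum.ext (IsLocalRing.eq_maximalIdeal (𝔭.isPrime.isMaximal hne)) :
        𝔭 = IsLocalRing.closedPoint O)
    · intro h𝔭
      have h𝔭' : 𝔭 = IsLocalRing.closedPoint O := h𝔭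
      rw [h𝔭']
      exact (IsLocalRing.mem_maximalIdeal _).mpr hϖ.not_isUnit
  rw [← h1, Scheme.preimage_zeroLocus, Set.image_singleton]
  rfl

/-- **[OURS · L1 W4.5(b)] CARRIER RIGIDITY (a), scheme-level EL♮ spelling** (res-L1-w45b-lead-2 RECONCILE 05:57:35Z:
«`O` DVR, `s` a section of `r : P → Spec O`, `τ : Bl → P` a blow-up along `ker s`; `C ⊂ Bl` an integral closed subscheme,
`O`-flat, whose special-fibre points all lie in the exceptional locus and are infinitely many ⇒ `C ⊆` the exceptional
locus»). Hypotheses: `P` integral, locally Noetherian and proper over `Spec O` (every EL♮ stage), `s` a closed immersion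
with `s ≫ r = 𝟙` (sections of the separated stages are), `C` an ideal sheaf on `Bl` with `V(C)` INTEGRAL and
`V(C) ↪ Bl → P → Spec O` FLAT. Flatness gives horizontality (flat morphisms are generalising, Mathlib `Flat.generalizingMap`:
a point of `V(C)` over the generic point of `Spec O` exists); the rest is `subset_preimage_support_of_infinite_specialFibre`
with `ϖ` a uniformizer (`zeroLocus_appTop_eq_preimage_closedPoint`) and `t₀ = s(s₀)` (`supp (ker s) = range s`,
Mathlib `Scheme.Hom.support_ker`). NOT a statement of the manuscript. [cite: StacksProject, Tag 080E; Matsumura1987, Thm. 15.5] -/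
theorem support_subset_preimage_of_flat_of_infinite_specialFibre
    {O : Type} [CommRing O] [IsDomain O] [IsDiscreteValuationRing O] {P Bl : Scheme.{0}}
    [IsIntegral P] [IsLocallyNoetherian P] (r : P ⟶ Spec (.of O)) [IsProper r]
    (s : Spec (.of O) ⟶ P) [IsClosedImmersion s] (hs : CategoryStruct.comp s r = CategoryStruct.id _)
    (τ : Bl ⟶ P) (hτ : IsBlowup τ s.ker) (C : Bl.IdealSheafData) (hCint : IsIntegral C.subscheme)
    (hflat : Flat (CategoryStruct.comp C.subschemeι (CategoryStruct.comp τ r)))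
    (hsp : (C.support : Set Bl) ∩ (CategoryStruct.comp τ r) ⁻¹' {IsLocalRing.closedPoint O} ⊆
      τ ⁻¹' (s.ker.support : Set P))
    (hinf : ((C.support : Set Bl) ∩ (CategoryStruct.comp τ r) ⁻¹' {IsLocalRing.closedPoint O}).Infinite) :
    (C.support : Set Bl) ⊆ τ ⁻¹' (s.ker.support : Set P) := by
  obtain ⟨ϖ, hϖ⟩ := IsDiscreteValuationRing.exists_irreducible O
  haveI : CompactSpace P := QuasiCompact.compactSpace_of_compactSpace r
  have hF : P.zeroLocus ({r.appTop ((Scheme.ΓSpecIso (.of O)).inv ϖ)} : Set Γ(P, ⊤)) =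
      r ⁻¹' {IsLocalRing.closedPoint O} :=
    zeroLocus_appTop_eq_preimage_closedPoint hϖ r
  have hF' : τ ⁻¹' P.zeroLocus ({r.appTop ((Scheme.ΓSpecIso (.of O)).inv ϖ)} : Set Γ(P, ⊤)) =
      (CategoryStruct.comp τ r) ⁻¹' {IsLocalRing.closedPoint O} := by
    rw [hF]
    ext x
    simp only [Set.mem_preimage, Scheme.Hom.comp_apply]
  -- the centre `ker s` meets the special fibre only at `s(s₀)`
  have hI : (s.ker.support : Set P) ∩ P.zeroLocus ({r.appTop ((Scheme.ΓSpecIso (.of O)).inv ϖ)} : Set Γ(P, ⊤)) ⊆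
      {s (IsLocalRing.closedPoint O)} := by
    rintro y ⟨hy, hyF⟩
    rw [hF] at hyF
    have hy' : y ∈ closure (Set.range s) := by
      rw [← Scheme.Hom.support_ker]; exact hy
    rw [s.isClosedEmbedding.isClosed_range.closure_eq] at hy'
    obtain ⟨u, rfl⟩ := hy'
    have hu : u = IsLocalRing.closedPoint O := by
      have h1 : r (s u) = IsLocalRing.closedPoint O := hyF
      rw [← Scheme.Hom.comp_apply, hs] at h1
      simpa using h1
    rw [hu]
    rfl
  -- `V(C)`: closed, irreducible (integral), horizontal (flat ⇒ generalising)
  have hCcl : IsClosed (C.support : Set Bl) := C.support.isClosed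
  haveI := hCint
  have hCirr : IsIrreducible (C.support : Set Bl) := by
    rw [← Scheme.IdealSheafData.range_subschemeι, ← Set.image_univ]
    exact (IrreducibleSpace.isIrreducible_univ _).image _ C.subschemeι.continuous.continuousOn
  have hCgen : ¬ (C.support : Set Bl) ⊆
      τ ⁻¹' P.zeroLocus ({r.appTop ((Scheme.ΓSpecIso (.of O)).inv ϖ)} : Set Γ(P, ⊤)) := by
    rw [hF']
    intro hsub
    obtain ⟨c₀, hc₀C, -⟩ := hinf.nonempty
    obtain ⟨z₀, hz₀⟩ : c₀ ∈ Set.range C.subschemeι := by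
      rw [Scheme.IdealSheafData.range_subschemeι]; exact hc₀C
    haveI := hflat
    have hgen := Flat.generalizingMap (CategoryStruct.comp C.subschemeι (CategoryStruct.comp τ r))
    let η₀ : Spec (.of O) := ⟨⊥, Ideal.isPrime_bot⟩
    have hη : η₀ ⤳ (CategoryStruct.comp C.subschemeι (CategoryStruct.comp τ r)) z₀ :=
      (PrimeSpectrum.le_iff_specializes η₀ _).mp bot_le
    obtain ⟨z', -, hz'η⟩ := hgen hη
    have hm : C.subschemeι z' ∈ (C.support : Set Bl) := by
      rw [← Scheme.IdealSheafData.range_subschemeι]; exact ⟨z', rfl⟩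
    have h2 : (CategoryStruct.comp C.subschemeι (CategoryStruct.comp τ r)) z' = IsLocalRing.closedPoint O := by
      have h3 : (CategoryStruct.comp τ r) (C.subschemeι z') = IsLocalRing.closedPoint O := hsub hm
      rw [Scheme.Hom.comp_apply]
      exact h3
    rw [hz'η] at h2
    exact IsDiscreteValuationRing.not_a_field O (congrArg PrimeSpectrum.asIdeal h2).symm
  have hCsp' : (C.support : Set Bl) ∩ τ ⁻¹' P.zeroLocus ({r.appTop ((Scheme.ΓSpecIso (.of O)).inv ϖ)} : Set Γ(P, ⊤)) ⊆
      τ ⁻¹' (s.ker.support : Set P) := by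
    rw [hF']; exact hsp
  have hinf' : ((C.support : Set Bl) ∩
      τ ⁻¹' P.zeroLocus ({r.appTop ((Scheme.ΓSpecIso (.of O)).inv ϖ)} : Set Γ(P, ⊤))).Infinite := by
    rw [hF']; exact hinf
  exact subset_preimage_support_of_infinite_specialFibre τ s.ker hτ _ (s (IsLocalRing.closedPoint O)) hI hCcl hCirr
    hCgen hCsp' hinf'

end Summit.ResolutionOfSingularities.ResolutionOfSingularities.Cruxes.EquisingularLiftNat.Sections
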